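import Summits.AtomisticToContinuum.BoseEinsteinCondensation.Theses.BECStronglyRayleigh
import Summits.AtomisticToContinuum.BoseEinsteinCondensation.Theorems.InsertionFieldDelocalisation.Negative.Toolkit
import Summits.AtomisticToContinuum.BoseEinsteinCondensation.Theorems.BECStronglyRayleighInsertionFieldDelocalisationGreenIdentities
import Summits.AtomisticToContinuum.BoseEinsteinCondensation.Theorems.BECStronglyRayleighInsertionFieldDelocalisationTorusGreenZeroBounded
import Literature.Probability.LatticeModels.TorusFourierProofs
import Literature.Probability.LatticeModels.IsingTransport
import HarnessLib

/-!
# Two-body base of line `cosh-budget-penrose-onsager` (crux `InsertionFieldDelocalisation`,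
# stmt-AtomisticToContinuum-9673), I: the Fourier half — a nonnegative punctured-resolvent profile
# on the torus is at most twice its mean

Helper file for the registered stub `stub_twoBodyBase` (the `N = 2` base of the Penrose–Onsager
induction).  After translation invariance, the pair amplitude `g(v) = φ({0, v})` (`g(0) = 0`) of the
two-body ground state of hard-core bosons on `(ℤ/Lℤ)³` solves the punctured resolvent equation

  `Σ_{y ∼ v} g(y) + E g(v) = s · [v = 0]`,  `s = Σ_{y ∼ 0} g(y) ≥ 0`,

with `E` the two-particle sector energy.  This file proves, by Fourier analysis on `(ℤ/Lℤ)^d`: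

* `cb1tb_fourier_max` : if the Fourier coefficients of a real `g` at the nonzero modes are real and
  nonpositive, then `g(v) + g(0) ≤ 2 · (Σ g)/L^d` (Bochner: `-(g - mean)` is positive definite, so
  its modulus is maximal at the origin);
* `cb1tb_fourier_eq` : the resolvent equation becomes `(Λ_k + E) ĝ(k) = s` with the hopping symbol
  `Λ_k = Σ_{b ∼ 0} χ_k(b)`, which is real (`cb1tb_hopSymbol_im`) and, for `k ≠ 0` on the three-torus
  with `L ≥ 2`, at most `deg(0) - 8/L²` (`cb1tb_hopSymbol_re_le`, one Jordan bound `g3bd_coord` in a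
  direction `i` with `kᵢ ≠ 0`);
* `cb1tb_profile_le` : hence, whenever `deg(0) + E < 8/L²`, every nonnegative-source solution
  satisfies `g(v) + g(0) ≤ 2 (Σ g)/L³`.
-/

noncomputable section

namespace Summit.AtomisticToContinuum.BoseEinsteinCondensation.Cruxes.InsertionFieldDelocalisation.CoshBudgetPenroseOnsager

open scoped BigOperators ComplexConjugate
open Literature.MathematicalPhysics.QuantumLattice Literature.Probability.LatticeModels Finset
open Summit.AtomisticToContinuum.BoseEinsteinCondensation.Cruxes.InsertionFieldDelocalisation.LogInsertionInfraredBound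
  (g12_torusChar_single_re g3bd_coord)

section Fourier

variable {d L : ℕ} [NeZero L]

/-- **Bochner on the finite torus.** If the Fourier coefficients of a real function `g` on
`(ℤ/Lℤ)^d` at all nonzero modes are real and nonpositive, then `g(v) + g(0) ≤ 2 (Σ g) / L^d` for
every `v` (inversion formula: the nonzero modes contribute `ĝ(k)(Re χ_k(v) + 1) ≤ 0`). [folklore] -/
theorem cb1tb_fourier_max (g : TorusSite d L → ℝ)
    (hk : ∀ k : TorusSite d L, k ≠ 0 →
      (torusFourier (fun x => (g x : ℂ)) k).im = 0 ∧ (torusFourier (fun x => (g x : ℂ)) k).re ≤ 0)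
    (v : TorusSite d L) : g v + g 0 ≤ 2 * (∑ x, g x) / (L : ℝ) ^ d := by
  set G : TorusSite d L → ℂ := torusFourier (fun x => (g x : ℂ)) with hG
  have hinv := torusFourier_inversion_holds (d := d) (L := L) (fun x => (g x : ℂ))
  have hv : ∀ w, (g w : ℂ) = ((L : ℂ) ^ d)⁻¹ * ∑ k, G k * torusChar k w := fun w => by
    rw [← torusFourierInv_eq_sum_torusChar]
    exact (congrFun hinv w).symm
  have hsum : ((g v + g 0 : ℝ) : ℂ) = ((L : ℂ) ^ d)⁻¹ * ∑ k, G k * (torusChar k v + 1) := by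
    push_cast
    rw [hv v, hv 0, ← mul_add, ← Finset.sum_add_distrib]
    congr 1
    refine Finset.sum_congr rfl fun k _ => ?_
    rw [torusChar_zero_right]
    ring
  have hc : ((L : ℂ) ^ d)⁻¹ = ((((L : ℝ) ^ d)⁻¹ : ℝ) : ℂ) := by push_cast; rfl
  have hre : g v + g 0 = ((L : ℝ) ^ d)⁻¹ * ∑ k, (G k * (torusChar k v + 1)).re := by
    have h := congrArg Complex.re hsum
    rw [Complex.ofReal_re, hc, Complex.re_ofReal_mul, Complex.re_sum] at h
    exact h
  -- the zero mode gives `2 Σ g`, the others are nonpositive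
  have h0 : (G 0 * (torusChar 0 v + 1)).re = 2 * ∑ x, g x := by
    rw [hG, torusFourier_apply_zero, torusChar_zero_left, ← Complex.ofReal_sum]
    have h2 : ((∑ x, g x : ℝ) : ℂ) * (1 + 1) = ((2 * ∑ x, g x : ℝ) : ℂ) := by push_cast; ring
    rw [h2, Complex.ofReal_re]
  have hneg : ∀ k ∈ (univ : Finset (TorusSite d L)).erase 0, (G k * (torusChar k v + 1)).re ≤ 0 := by
    intro k hk'
    have hk0 : k ≠ 0 := (Finset.mem_erase.1 hk').1
    obtain ⟨him, hle⟩ := hk k hk0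
    rw [Complex.mul_re, him, zero_mul, sub_zero, Complex.add_re, Complex.one_re]
    have hχ : -1 ≤ (torusChar k v).re := by
      have h := Complex.abs_re_le_norm (torusChar k v)
      rw [norm_torusChar] at h
      exact (abs_le.1 h).1
    exact mul_nonpos_of_nonpos_of_nonneg hle (by linarith)
  have hsplit : ∑ k, (G k * (torusChar k v + 1)).re ≤ 2 * ∑ x, g x := by
    rw [← Finset.add_sum_erase _ _ (Finset.mem_univ (0 : TorusSite d L)), h0]
    linarith [Finset.sum_nonpos hneg]
  have hL : (0 : ℝ) < ((L : ℝ) ^ d)⁻¹ := by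
    have : (0 : ℝ) < L := by exact_mod_cast Nat.pos_of_ne_zero (NeZero.ne L)
    positivity
  rw [hre, div_eq_inv_mul]
  exact mul_le_mul_of_nonneg_left hsplit hL.le

omit [NeZero L] in
/-- Translation invariance of torus adjacency, centred: `v ∼ y ↔ 0 ∼ y - v`. [folklore] -/
theorem cb1tb_adj_iff_sub (v y : TorusSite d L) :
    (torusGraph d L).Adj v y ↔ (torusGraph d L).Adj 0 (y - v) := by
  have h := torusGraph_adj_add_right (-v) v y
  rw [add_neg_cancel, ← sub_eq_add_neg] at h
  exact h.symm

/-- The adjacency sum against a conjugate character factors through the **hopping symbol**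
`Λ_k = Σ_{b ∼ 0} χ_k(b)`: `Σ_v [v ∼ y] conj χ_k(v) = conj χ_k(y) · Λ_k`. [folklore] -/
theorem cb1tb_sum_adj_conj_char (k y : TorusSite d L) :
    ∑ v, (if (torusGraph d L).Adj v y then conj (torusChar k v) else 0) =
      conj (torusChar k y) * ∑ b, (if (torusGraph d L).Adj 0 b then torusChar k b else 0) := by
  rw [Finset.mul_sum]
  refine Fintype.sum_equiv (Equiv.subLeft y) _ _ fun v => ?_
  rw [Equiv.subLeft_apply]
  have hadj : (torusGraph d L).Adj v y ↔ (torusGraph d L).Adj 0 (y - v) := cb1tb_adj_iff_sub v y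
  by_cases h : (torusGraph d L).Adj v y
  · rw [if_pos h, if_pos (hadj.1 h), torusChar_sub_right]
    calc conj (torusChar k v) = torusChar k y * conj (torusChar k y) * conj (torusChar k v) := by
          rw [torusChar_mul_conj, one_mul]
      _ = conj (torusChar k y) * (torusChar k y * conj (torusChar k v)) := by ring
  · rw [if_neg h, if_neg (fun h' => h (hadj.2 h')), mul_zero]

/-- **The punctured resolvent equation in Fourier variables**: if
`Σ_{y ∼ v} g(y) + E g(v) = s [v = 0]` on `(ℤ/Lℤ)^d`, then `(Λ_k + E) ĝ(k) = s` for every mode `k`,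
`Λ_k = Σ_{b ∼ 0} χ_k(b)`. [folklore] -/
theorem cb1tb_fourier_eq (g : TorusSite d L → ℝ) (E s : ℝ)
    (heq : ∀ v, (∑ y, if (torusGraph d L).Adj v y then g y else 0) + E * g v =
      if v = 0 then s else 0)
    (k : TorusSite d L) :
    ((∑ b, (if (torusGraph d L).Adj 0 b then torusChar k b else 0)) + E) *
      torusFourier (fun x => (g x : ℂ)) k = s := by
  set Λ := ∑ b, (if (torusGraph d L).Adj 0 b then torusChar k b else 0) with hΛ
  rw [torusFourier_eq_sum_torusChar]
  -- pair the equation with `conj χ_k`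
  have hsum : ∑ v, (((∑ y, if (torusGraph d L).Adj v y then g y else 0) + E * g v : ℝ) : ℂ) *
      conj (torusChar k v) = ∑ v, ((if v = 0 then s else 0 : ℝ) : ℂ) * conj (torusChar k v) :=
    Finset.sum_congr rfl fun v _ => by rw [heq v]
  have hR : ∑ v, ((if v = 0 then s else 0 : ℝ) : ℂ) * conj (torusChar k v) = s := by
    rw [Finset.sum_eq_single (0 : TorusSite d L)]
    · simp
    · intro v _ hv
      rw [if_neg hv, Complex.ofReal_zero, zero_mul]
    · intro h
      exact absurd (Finset.mem_univ _) h
  have hA : ∑ v, (((∑ y, if (torusGraph d L).Adj v y then g y else 0) : ℝ) : ℂ) *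
      conj (torusChar k v) = Λ * ∑ x, (g x : ℂ) * conj (torusChar k x) := by
    calc ∑ v, (((∑ y, if (torusGraph d L).Adj v y then g y else 0) : ℝ) : ℂ) * conj (torusChar k v)
        = ∑ v, ∑ y, (g y : ℂ) * (if (torusGraph d L).Adj v y then conj (torusChar k v) else 0) := by
          refine Finset.sum_congr rfl fun v _ => ?_
          rw [Complex.ofReal_sum, Finset.sum_mul]
          refine Finset.sum_congr rfl fun y _ => ?_
          split_ifs
          · rfl
          · rw [Complex.ofReal_zero, zero_mul, mul_zero]
      _ = ∑ y, (g y : ℂ) * ∑ v, (if (torusGraph d L).Adj v y then conj (torusChar k v) else 0) := by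
          rw [Finset.sum_comm]
          exact Finset.sum_congr rfl fun y _ => by rw [Finset.mul_sum]
      _ = Λ * ∑ x, (g x : ℂ) * conj (torusChar k x) := by
          rw [Finset.mul_sum]
          refine Finset.sum_congr rfl fun y _ => ?_
          rw [cb1tb_sum_adj_conj_char, hΛ]
          ring
  have hL : ∑ v, (((∑ y, if (torusGraph d L).Adj v y then g y else 0) + E * g v : ℝ) : ℂ) *
      conj (torusChar k v) = (Λ + E) * ∑ x, (g x : ℂ) * conj (torusChar k x) := by
    calc ∑ v, (((∑ y, if (torusGraph d L).Adj v y then g y else 0) + E * g v : ℝ) : ℂ) *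
          conj (torusChar k v)
        = ∑ v, ((((∑ y, if (torusGraph d L).Adj v y then g y else 0) : ℝ) : ℂ) *
            conj (torusChar k v) + (E : ℂ) * ((g v : ℂ) * conj (torusChar k v))) :=
          Finset.sum_congr rfl fun v _ => by push_cast; ring
      _ = (Λ + E) * ∑ x, (g x : ℂ) * conj (torusChar k x) := by
          rw [Finset.sum_add_distrib, hA, ← Finset.mul_sum]
          ring
  rw [← hL, hsum, hR]

/-- **The hopping symbol is real**: `Λ_k = Σ_{b ∼ 0} χ_k(b)` is invariant under `b ↦ -b`
(the neighbourhood of the origin is symmetric), which conjugates each character. [folklore] -/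
theorem cb1tb_hopSymbol_im (k : TorusSite d L) :
    (∑ b, (if (torusGraph d L).Adj 0 b then torusChar k b else 0)).im = 0 := by
  set Λ := ∑ b, (if (torusGraph d L).Adj 0 b then torusChar k b else 0) with hΛ
  have hsymm : ∀ b : TorusSite d L, (torusGraph d L).Adj 0 b ↔ (torusGraph d L).Adj 0 (-b) := by
    intro b
    have h := torusGraph_adj_add_right (-b) 0 b
    rw [zero_add, add_neg_cancel] at h
    rw [← h]
    exact (torusGraph d L).adj_comm _ _
  have hconj : conj Λ = Λ := by
    rw [hΛ, map_sum]
    calc ∑ b, conj (if (torusGraph d L).Adj 0 b then torusChar k b else 0)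
        = ∑ b, (if (torusGraph d L).Adj 0 (-b) then torusChar k (-b) else 0) := by
          refine Finset.sum_congr rfl fun b _ => ?_
          by_cases h : (torusGraph d L).Adj 0 b
          · rw [if_pos h, if_pos ((hsymm b).1 h), torusChar_neg_right]
          · rw [if_neg h, if_neg (fun h' => h ((hsymm b).2 h')), map_zero]
      _ = ∑ b, (if (torusGraph d L).Adj 0 b then torusChar k b else 0) :=
          Fintype.sum_equiv (Equiv.neg _) _ _ fun b => rfl
  exact Complex.conj_eq_iff_im.1 hconj

omit [NeZero L] in
/-- The origin is adjacent to each unit vector on a torus of side `L ≥ 2`. [folklore] -/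
theorem cb1tb_adj_zero_single (hL : 2 ≤ L) (i : Fin d) :
    (torusGraph d L).Adj 0 (Pi.single i (1 : ZMod L)) := by
  haveI : Fact (1 < L) := ⟨hL⟩
  rw [torusGraph_adj_iff]
  refine ⟨fun h => ?_, Or.inl ⟨i, by rw [zero_add]⟩⟩
  have h1 := congrFun h i
  simp at h1

/-- **One Jordan bound on the hopping symbol**: for `k ≠ 0` on `(ℤ/Lℤ)³`, `L ≥ 2`,
`Re Λ_k ≤ deg(0) - 8/L²` (drop all neighbours but `eᵢ` with `kᵢ ≠ 0`; there
`1 - cos p_k,i ≥ 8 mᵢ²/L² ≥ 8/L²`, `mᵢ = valMinAbs kᵢ ≠ 0`). [folklore] -/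
theorem cb1tb_hopSymbol_re_le (L : ℕ) [NeZero L] (hL : 2 ≤ L) {k : TorusSite 3 L} (hk : k ≠ 0) :
    (∑ b, (if (torusGraph 3 L).Adj 0 b then torusChar k b else 0)).re ≤
      (∑ b : TorusSite 3 L, (if (torusGraph 3 L).Adj 0 b then (1 : ℝ) else 0)) - 8 / (L : ℝ) ^ 2 := by
  -- a direction in which `k` moves
  obtain ⟨i, hi⟩ : ∃ i, k i ≠ 0 := by
    by_contra h
    push Not at h
    exact hk (funext h)
  set e : TorusSite 3 L := Pi.single i 1 with he
  have hadj : (torusGraph 3 L).Adj 0 e := cb1tb_adj_zero_single hL i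
  -- the defect `Σ_{b ∼ 0} (1 - Re χ_k(b)) ≥ 1 - cos p_k,i ≥ 8/L²`
  rw [Complex.re_sum]
  have hre : ∀ b : TorusSite 3 L, (if (torusGraph 3 L).Adj 0 b then torusChar k b else 0).re =
      (if (torusGraph 3 L).Adj 0 b then (1 : ℝ) else 0) -
        (if (torusGraph 3 L).Adj 0 b then 1 - (torusChar k b).re else 0) := by
    intro b
    split_ifs
    · ring
    · simp
  simp_rw [hre]
  rw [Finset.sum_sub_distrib]
  have hterm : ∀ b ∈ (univ : Finset (TorusSite 3 L)),
      0 ≤ (if (torusGraph 3 L).Adj 0 b then 1 - (torusChar k b).re else 0) := by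
    intro b _
    split_ifs
    · have h := Complex.re_le_norm (torusChar k b)
      rw [norm_torusChar] at h
      linarith
    · exact le_rfl
  have hsingle : (if (torusGraph 3 L).Adj 0 e then 1 - (torusChar k e).re else 0) ≤
      ∑ b, (if (torusGraph 3 L).Adj 0 b then 1 - (torusChar k b).re else 0) :=
    Finset.single_le_sum hterm (Finset.mem_univ e)
  rw [if_pos hadj, he, g12_torusChar_single_re] at hsingle
  have hjordan := g3bd_coord L k i
  have hm : (1 : ℝ) ≤ ((k i).valMinAbs : ℝ) ^ 2 := by
    have h0 : (k i).valMinAbs ≠ 0 := fun h => hi ((ZMod.valMinAbs_eq_zero (k i)).1 h)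
    have h1 : (1 : ℤ) ≤ (k i).valMinAbs ^ 2 := (one_le_sq_iff_one_le_abs _).2 (Int.one_le_abs h0)
    exact_mod_cast h1
  have hL0 : (0 : ℝ) < (L : ℝ) ^ 2 := by
    have : (0 : ℝ) < L := by exact_mod_cast Nat.pos_of_ne_zero (NeZero.ne L)
    positivity
  have h8 : 8 / (L : ℝ) ^ 2 ≤ 8 * ((k i).valMinAbs : ℝ) ^ 2 / (L : ℝ) ^ 2 := by
    rw [div_le_div_iff_of_pos_right hL0]
    nlinarith
  linarith

/-- **The profile bound.** On `(ℤ/Lℤ)³`, `L ≥ 2`: if `g` solves the punctured resolvent equation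
`Σ_{y ∼ v} g(y) + E g(v) = s [v = 0]` with `s ≥ 0` and `deg(0) + E < 8/L²`, then
`g(v) + g(0) ≤ 2 (Σ g)/L³` for every `v` (all nonzero modes have `Λ_k + E < 0`, so
`ĝ(k) = s/(Λ_k + E) ≤ 0`, and `cb1tb_fourier_max` applies). [folklore] -/
theorem cb1tb_profile_le (L : ℕ) [NeZero L] (hL : 2 ≤ L) (g : TorusSite 3 L → ℝ) (E s : ℝ)
    (hs : 0 ≤ s)
    (hE : (∑ b : TorusSite 3 L, (if (torusGraph 3 L).Adj 0 b then (1 : ℝ) else 0)) + E <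
      8 / (L : ℝ) ^ 2)
    (heq : ∀ v, (∑ y, if (torusGraph 3 L).Adj v y then g y else 0) + E * g v =
      if v = 0 then s else 0)
    (v : TorusSite 3 L) : g v + g 0 ≤ 2 * (∑ x, g x) / (L : ℝ) ^ 3 := by
  refine cb1tb_fourier_max g (fun k hk => ?_) v
  set Λ := ∑ b, (if (torusGraph 3 L).Adj 0 b then torusChar k b else 0) with hΛ
  have hΛim : Λ.im = 0 := cb1tb_hopSymbol_im k
  have hΛre := cb1tb_hopSymbol_re_le L hL hk
  have hneg : Λ.re + E < 0 := by linarith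
  have hprod := cb1tb_fourier_eq g E s heq k
  have hμ : (Λ + E : ℂ) = ((Λ.re + E : ℝ) : ℂ) := by
    apply Complex.ext
    · simp
    · simp [hΛim]
  rw [← hΛ, hμ] at hprod
  have hne : Λ.re + E ≠ 0 := hneg.ne
  have hG : torusFourier (fun x => (g x : ℂ)) k = ((s / (Λ.re + E) : ℝ) : ℂ) := by
    rw [Complex.ofReal_div, eq_div_iff (Complex.ofReal_ne_zero.mpr hne), mul_comm]
    exact hprod
  rw [hG, Complex.ofReal_im, Complex.ofReal_re]
  exact ⟨rfl, div_nonpos_iff.2 (Or.inl ⟨hs, hneg.le⟩)⟩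

end Fourier

/-- **Registered helper stub `stub_twoBodyBaseProfile`** (sub-goal of `stub_twoBodyBase`, line
`cosh-budget-penrose-onsager`): on `(ℤ/Lℤ)³`, `L ≥ 2`, a solution `g` of the punctured resolvent
equation `Σ_{y ∼ v} g(y) + E g(v) = s [v = 0]` with `s ≥ 0` and `deg(0) + E < 8/L²` satisfies
`g(v) + g(0) ≤ 2 (Σ g)/L³` (`cb1tb_profile_le`). [folklore] -/
theorem stub_twoBodyBaseProfile :
    ∀ (L : ℕ) [NeZero L], 2 ≤ L → ∀ (g : TorusSite 3 L → ℝ) (E s : ℝ), 0 ≤ s →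
      (∑ b : TorusSite 3 L, (if (torusGraph 3 L).Adj 0 b then (1 : ℝ) else 0)) + E < 8 / (L : ℝ) ^ 2 →
      (∀ v, (∑ y, if (torusGraph 3 L).Adj v y then g y else 0) + E * g v = if v = 0 then s else 0) →
      ∀ v, g v + g 0 ≤ 2 * (∑ x, g x) / (L : ℝ) ^ 3 :=
  fun L _ hL g E s hs hE heq v => cb1tb_profile_le L hL g E s hs hE heq v

end Summit.AtomisticToContinuum.BoseEinsteinCondensation.Cruxes.InsertionFieldDelocalisation.CoshBudgetPenroseOnsager

end
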